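import Summits.Ventures.PackingBounds.Conjectures.DiploSimplexRiesz
import HarnessLib
import HarnessLib.Audit.Tags

/-!
# Conjecture B, interval-free core — and the numerical NON-interval phenomenon at `n = 9`

Framing: lottery ticket; floor = certified bounds/negative ranges. Venture `PackingBounds` (cell `pub-packcert`, seat
`pub-packcert-energy`, gen 26) — typing addendum to `Conjectures/DiploSimplexRiesz.lean` (append-only: the original `ConjectureB`
stays as stated; this file records why its THRESHOLD FORM is numerically untenable at `n = 9` and types the surviving core).

`ConjectureB` (PAPER-diplo-g25 §18.3, typed in `DiploSimplexRiesz`): for every `n ≥ 6` there is `s*(n) ≥ n - 2` with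
`DiploMinimises n s ↔ s ≤ s*(n)` for all `s > 0` — i.e. the set of Riesz exponents at which the diplo-simplex is optimal is an INTERVAL.
NUMERICAL EVIDENCE AGAINST THE INTERVAL FORM AT `n = 9` (cell energy gen 26, pre-registered multistart runs P-E15 / P-E15b, kits j251483 / j251551,
HOME code/e3pt/g26/negative/probe9*-results-*.json): the competitor `X_9` (Petersen code ⊕ `β_5`, `Conjectures/DiploSimplexPetersenCross`) has
smaller energy than `D_9` exactly on the window `11.60 < s < 17.48` (closed forms; kernel instances `¬ DiploMinimises 9 12`, `¬ DiploMinimises 9 14`),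
and the multistart optimum of `(9, 20)` is `X_9` at `s = 12, 15, 17` (119–124 of 192 starts) but `D_9` AGAIN at `s = 18` (84 of 192 starts reach
`E_18(D_9) = 1.1510666301` exactly, NOTHING below; 37/72 in the first run), while at `s = 20, 22` other symmetric configurations (151/192 resp. 94/192 starts;
inner products `±0.124, ±0.106, ±0.088, 0.102`, … ) lie below `D_9` (by `3.9e-4`, `1.7e-3`) and at `s = 25` a generic configuration does. So, numerically,
`{s : D_9 minimises E_s}` contains `(0, 11.6]` and a short interval around `s = 18` but not `12 … 17.5` nor `s ≥ 20`: NOT an interval, and `ConjectureB` is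
false AS TYPED if `D_9` really minimises at `s = 18` (which cannot be proved here). For `n = 7, 8` the generic large-`s` regime takes over inside the
`X_n` window (P-E17), and for `n = 10, 11, 12` there is no window (P-E15(B), P-E16), so the phenomenon is specific to `n = 9` among `5 ≤ n ≤ 12`. What survives all data (n = 5, …, 10; P-E13/14/15): the diplo-simplex is optimal for every
exponent up to the harmonic one — the interval-free core below (`ConjectureBcore`), which `ConjectureB` implies (`core_of_conjectureB`) and which still
contains the BBCGKS harmonic conjecture (`bbcgksHarmonic_of_core`).

## References
* B. Ballinger et al., Experiment. Math. 18 (2009) 257–283, §3.4. [`BallingerEtAl2009`]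
-/

noncomputable section

namespace Summit.Ventures.PackingBounds.Conjectures

/-- **CONJECTURE B, interval-free core (gen 26).** For every `n ≥ 6` and every `0 < s ≤ n - 2` the diplo-simplex `D_n` minimises the Riesz-`s` energy among
`(2n+2)`-point subsets of `S^{n-1}` (no claim about larger `s`: at `n = 9` the optimal set of exponents is numerically NOT an interval). OPEN; evidence:
31 certified `(n, s)` members with `s ≤ 4` (PACK-TABLE §B4c) and the multistart runs P-E13/14/15 (harmonic exponents `n = 6, 7, 8`; `n = 10` at `s = 16`). -/
@[conjecture] def ConjectureBcore : Prop :=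
  ∀ n : ℕ, 6 ≤ n → ∀ s : ℝ, 0 < s → s ≤ (n : ℝ) - 2 → DiploMinimises n s

/-- The typed threshold form implies the core. -/
theorem core_of_conjectureB (hB : ConjectureB) : ConjectureBcore := by
  intro n hn s hs hsle
  obtain ⟨sStar, hge, hiff⟩ := hB n hn
  exact (hiff s hs).2 (le_trans hsle hge)

/-- The core still contains the BBCGKS harmonic conjecture (`s = n - 2 > 0` for `n ≥ 6`). -/
theorem bbcgksHarmonic_of_core (h : ConjectureBcore) : BBCGKSHarmonic := by
  intro n hn
  have hn6 : (6 : ℝ) ≤ n := by exact_mod_cast hn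
  exact h n hn ((n : ℝ) - 2) (by linarith) le_rfl

/-- The core implies the inequality half of Conjecture A (`0 < s ≤ 1 ≤ n - 2`). -/
theorem diploMinimises_of_core (h : ConjectureBcore) (n : ℕ) (hn : 6 ≤ n) (s : ℝ) (hs : 0 < s) (hs1 : s ≤ 1) :
    DiploMinimises n s := by
  have hn6 : (6 : ℝ) ≤ n := by exact_mod_cast hn
  exact h n hn s hs (by linarith)

end Summit.Ventures.PackingBounds.Conjectures

end
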